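import Summits.BirchSwinnertonDyer.Rank1Residual.ManinAdditive.JumpDegreeLaws
import Summits.BirchSwinnertonDyer.Rank1Residual.ManinAdditive.TameCellLocalTwoTorsion
import HarnessLib
import HarnessLib.Audit.Tags

/-!
# es g36 (cell bsd-f2-manin, MEMO-es §57) — HASSE DEPTH on the tame cell `4 ∥ N` and two `4 ∣ deg φ` laws

Typed rows of MEMO-es §57 («the Grothendieck–Messing road»).  Nothing is asserted: the `@[conjecture]` nodes are
CENSUS LAWS / a DICTIONARY (Tate casework) with their BC5 tables; the proved declarations are one-line edges.

* E-es-170 / 170′ `FourStarHasseDepthDictionary` / `FourHasseDepthDictionary` (DICTIONARY, PARTITION 0, Tate casework;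
  the `c₄`-currency of desc's T-desc-IV♮ `TypeFourStarLocalTwoTorsionCriterion` / `TypeFourLocalTwoTorsionCriterion`,
  MEMO-desc §33.15): on `4 ∥ N`, for a globally minimal model, IV* : `v₂(c₄) = 4 ⟺ E(ℚ₂)[2] ≠ 0`;
  IV : `v₂(c₄) = 4 ⟺ E(ℚ₂)[2] = 0`.  §57 reading: `v₂(c₄)` measures the HASSE DEPTH `h(E) = v_ϖ(a₁')` of a good model of
  `E` over the semistable field `L = ℚ₂^nr(∛2)` (`v_ϖ(c₄') = 3·v₂(c₄) − 4·(3·jump) ∈ {4, 8} ∪ [9, ∞)`): IV* has `h = 1`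
  iff `v₂(c₄) = 4` (canonical subgroup of order 2 ⟹ a `ℚ₂`-rational 2-torsion point), else `h ≥ 3`; IV has `h = 2` iff
  `v₂(c₄) = 4`, else `h ≥ 3`.  Census (Cremona, all 215 648 curves with `4 ∥ N < 5·10⁵`): IV* 119 179 / 119 179,
  IV 96 469 / 96 469; gap rows E-es-170g: IV* ⟹ `v₂(c₄) ∉ {5, 6}`, IV ⟹ `v₂(c₄) ≥ 4 ∧ v₂(c₄) ≠ 5` (0 exceptions).
* E-es-168 `FourStarLocalTwoTorsionFourDividesDegree` (LAW, new in the cell; §57 mechanism: at Hasse depth 1 the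
  Kodaira–Spencer class of `E_L` is non-zero, and by the Grothendieck–Messing second-order lemma (57.G/H) `m_L ≥ 2` iff every
  component isogeny `φ̄_y` of the semistable fibre is divisible by `2` in the Hurwitz order, whence `4 ∣ deg φ̄_y` for all `y`
  and `4 ∣ deg φ = Σ_y deg φ̄_y` (desc THEOREM P (b))): IV* at `2`, `E(ℚ₂)[2] ≠ 0`, `E(ℚ)[2] = 0` ⟹ `4 ∣ deg φ` for EVERY
  parametrisation at the conductor level.  Census: 37 466 / 37 466 curves (33 929 optimal + 3 537 non-optimal), 0
  exceptions; necessity of `E(ℚ₂)[2] ≠ 0`: 133 optimal IV* curves with `E(ℚ₂)[2] = 0` have `deg φ ≡ 2 (mod 4)` (44a1, 76a1,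
  108a1, 268a1, …); necessity of `E(ℚ)[2] = 0`: 20a1/a3, 52a1, 36a2/a4 (degrees 1, 3, 3, 2, 6).
* E-es-169 / 169b `GaussianLevelFourDividesDegree` / `…WithTorsion` (LAW, new in the cell): `4 ∥ N`, every odd prime
  factor of `N` `≡ 1 (mod 4)`, `E(ℚ)[2] = 0` ⟹ `4 ∣ deg φ` (7 256 / 7 256 curves, all parametrisations at conductor
  level); with a rational 2-torsion point the same holds off the `4(s² + 4)` levels (2 866 / 2 866); the only Gaussian-level
  curves with `4 ∤ deg φ` are the 112 curves of the 55 `s² + 4` classes (optimal IV* odd, its IV isogenous curves `≡ 2 (4)`,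
  20a3).
Tables: HOME/es/g36/out-hasse2-500000.txt fb828395ae0728fb (engine hasse_depth_census2.py a17f2a2117ebfc29),
HOME/es/g36/out-census3-500000.txt 9dea1f186a15672c (engine census3.py 956862cbffd35d72).
PARTITION 0 · beyond-print theorem: no (laws + Tate-casework dictionary; the §57 mechanism is on paper) · BSD is not proved by this.

TYPER NOTE (typer g21, T-es-67).  SOURCE = HOME/es/g36/Sketch-es-g36.lean sha16 6c1123b7d8b5b975 (168 l.; es: farm rc 0·0·0·0, 6 @[conjecture] + 3 proved
edges; BC7 6/6 CLEAN HOME/es/g36/probe-plain.txt; MEMO-es §57, HOME/es/g36/MEMO-es-sec57.md; tables out-hasse2-500000.txt fb828395ae0728fb,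
out-census3-500000.txt 9dea1f186a15672c) VERBATIM but for two typer deltas: (i) namespace `…ManinAdditive.EsG36` → `…ManinAdditive.HasseDepth`
(es: «ns at your discretion»; files and namespaces are named for the MATHEMATICS, not the seat), (ii) cite key `Silverman2009AEC` → the tree's
`SilvermanAEC2009` (same book; the unknown key would bounce).  Imports: landed `…ManinAdditive.JumpDegreeLaws` + `…ManinAdditive.TameCellLocalTwoTorsion`
+ HarnessLib(+Audit.Tags) — Theses-free (closure 6 modules).  ROWS (es's `@[conjecture]` tags, nothing asserted): **E-es-170 `FourStarHasseDepthDictionary`**,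
**E-es-170′ `FourHasseDepthDictionary`**, **E-es-170g `TameCellC4GapLaw`**, **E-es-168 `FourStarLocalTwoTorsionFourDividesDegree`** (37 466/37 466),
**E-es-169 `GaussianLevelFourDividesDegree`** (7 256/7 256), **E-es-169b `GaussianLevelFourDividesDegreeWithTorsion`** (2 866/2 866); PROVED edges
`four_dvd_modularDegree_of_fourStar_c4`, `four_dvd_modularDegree_of_not_hasPrimeFactorThreeModFour`, `four_dvd_modularDegree_of_laws`.  REFUTER:
ref1 R-es-83 PENDING at landing.  9 decl names fresh; no instances, no notation, no sorry.  `--supports` refused for ManinAdditive ⇒ bears_on: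
stmt-BirchSwinnertonDyer-22967 (C2 `ManinOddAtFour`).  BSD is not proved by this; C2 OPEN.
-/

open scoped MatrixGroups ModularForm

open CongruenceSubgroup WeierstrassCurve Literature.NumberTheory.EllipticCurves.ModularForms

open Summit.BirchSwinnertonDyer.Rank1Residual.ManinAdditive.ConwayCut
open Summit.BirchSwinnertonDyer.Rank1Residual.ManinAdditive.JumpDegree
open Summit.BirchSwinnertonDyer.Rank1Residual.ManinAdditive.TameTwoLocal

namespace Summit.BirchSwinnertonDyer.Rank1Residual.ManinAdditive.HasseDepth

/-! ### §1. The Hasse-depth dictionary (Tate casework; PARTITION 0) -/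

/-- **Row E-es-170 `FourStarHasseDepthDictionary`** (DICTIONARY; es g36 MEMO-es §57.4; = the `c₄`-currency of desc's
T-desc-IV♮(b); nothing asserted).  For a globally minimal `W` with `4 ∥ N` and Kodaira IV* at `2` (`v₂Δ = 8`):
`v₂(c₄) = 4` ⟺ the 2-division cubic has a root in `ℚ₂` (`E(ℚ₂)[2] ≠ 0`).  §57: both sides say «Hasse depth `h(E) = 1`»
(`v_ϖ` of the Hasse invariant of the good `𝒪_L`-model, `L = ℚ₂^nr(∛2)`), ⟹-direction = Lubin–Katz canonical subgroup.
Census: 119 179 / 119 179 IV* curves with `4 ∥ N < 5·10⁵` (69 539 with, 49 640 without local 2-torsion).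
Why it might fail: only by a slip in Tate's case analysis; 0 exceptions below `5·10⁵`.
[cite: SilvermanAEC2009, Ch. VII and App. C §15 Table 15.1 (Tate's algorithm / Kodaira–Néron table: the valuations of c₄, c₆, Δ by type — the row itself is the cell's E-es-170, NOT in print as stated)] -/
@[conjecture]
def FourStarHasseDepthDictionary : Prop :=
  ∀ (W : WeierstrassCurve ℚ) [W.IsElliptic] [W.IsGloballyMinimal],
    IsTypeFourStarAtTwoTame W → (padicValRat 2 W.c₄ = 4 ↔ ¬ NoLocalTwoTorsionAtTwo W)

/-- **Row E-es-170′ `FourHasseDepthDictionary`** (DICTIONARY; = the `c₄`-currency of desc's T-desc-IV♮(a)).  For a globally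
minimal `W` with `4 ∥ N` and Kodaira IV at `2` (`v₂Δ = 4`): `v₂(c₄) = 4` ⟺ `E(ℚ₂)[2] = 0` (Hasse depth `h = 2`; else
`h ≥ 3` and `E ⊗ 𝒪_L/2` is a constant family).  Census: 96 469 / 96 469 IV curves (38 374 with `v₂(c₄) = 4`, none of
them with local 2-torsion; 58 095 with `v₂(c₄) ≥ 6`, all with). -/
@[conjecture]
def FourHasseDepthDictionary : Prop :=
  ∀ (W : WeierstrassCurve ℚ) [W.IsElliptic] [W.IsGloballyMinimal],
    padicValNat 2 (W.conductorNorm ℤ) = 2 → padicValRat 2 W.Δ = 4 →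
      (padicValRat 2 W.c₄ = 4 ↔ NoLocalTwoTorsionAtTwo W)

/-- **Row E-es-170g `TameCellC4GapLaw`** (DICTIONARY; Tate casework; §57: `v_ϖ(c₄') = 3v₂(c₄) − 4·(3·jump)` lies in
`{4, 8} ∪ [9, ∞)` because `c₄' ≡ a₁'⁴ (mod 8)` on a good `𝒪_L`-model).  On the tame cell, for a globally minimal `W`:
`v₂(c₄) ≥ 4` and `v₂(c₄) ≠ 5`; for IV* moreover `v₂(c₄) ≠ 6`.  Census: 215 648 / 215 648 (`c₄ = 0` counted as `∞`:
the valuation statement is then about `padicValRat 2 0 = 0`, so the row is stated for `W.c₄ ≠ 0`). -/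
@[conjecture]
def TameCellC4GapLaw : Prop :=
  ∀ (W : WeierstrassCurve ℚ) [W.IsElliptic] [W.IsGloballyMinimal],
    padicValNat 2 (W.conductorNorm ℤ) = 2 → W.c₄ ≠ 0 →
      4 ≤ padicValRat 2 W.c₄ ∧ padicValRat 2 W.c₄ ≠ 5 ∧ (padicValRat 2 W.Δ = 8 → padicValRat 2 W.c₄ ≠ 6)

/-! ### §2. The two `4 ∣ deg φ` laws -/

/-- **Row E-es-168 `FourStarLocalTwoTorsionFourDividesDegree`** (LAW; es g36 MEMO-es §57.5; nothing asserted).  Every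
modular parametrisation `X₀(N) → E` at the conductor level of a curve with `4 ∥ N`, Kodaira IV* at `2`, a `ℚ₂`-RATIONAL
2-torsion point and NO rational 2-torsion point has degree divisible by `4`.  Census (Cremona, `N < 5·10⁵`, all curves):
37 466 / 37 466 (optimal 2 821 Gaussian + 31 108 non-Gaussian levels; non-optimal 193 + 3 344), 0 exceptions.  Both side
conditions are necessary: 133 optimal IV* curves WITHOUT local 2-torsion have `deg φ ≡ 2 (mod 4)` (44a1 `2`, 76a1 `6`,
108a1 `6`, 268a1 `18`, 972a1 `54`); with rational 2-torsion 20a1 `1`, 20a3 `3`, 52a1 `3`, 36a2 `2`, 36a4 `6`.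
Mechanism offered (§57, on paper, NOT a proof of the row): `E(ℚ₂)[2] ≠ 0` ⟺ Hasse depth 1 ⟺ the Kodaira–Spencer class
of the good `𝒪_L`-model is non-zero mod `ϖ`; then (Grothendieck–Messing over `𝒪_L/ϖ²`, trivial divided powers) the
pulled-back Néron differential vanishes to order `≥ 2` along the semistable fibre iff every component isogeny `φ̄_y` lies in
`2·Hom(E_y, Ē)`, which forces `4 ∣ deg φ̄_y` for all `y` and `4 ∣ deg φ` (desc THEOREM P (b)); the row then says that the
order is `2`, i.e. (desc LEMMA D) `ord₂(c_E) = 0 ∧ μ(f) = 0` — Manin at `2` WITH regularity of `f` on the semistable model.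
In print: Calegari–Emerton give `2 ∣ deg φ` for `E[2]` irreducible; Dummigan–Krishnamoorthy-type Atkin–Lehner counts give
`2^{ω(N)−1−…}`, i.e. nothing beyond `2` at `N = 4p`; a `4 ∣` law keyed to LOCAL 2-torsion at an additive prime was not found.
Why it might fail: a IV* curve at a large Gaussian level with two type-`C₂` component maps of Hurwitz depth exactly 1
(`deg φ̄_y ≡ 2 (mod 4)` twice is still `≡ 0`; ONE such pair plus an odd number of depth-1 type-1 maps would break it).
[cite: CalegariEmerton2009, Thm. 1.1 (arXiv:math/0503359 p. 2: E[2] irreducible and 4 ∣ N ⇒ deg φ even — the binary floor this row doubles; the row is the cell's E-es-168, NOT in print)]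
[cite: Watkins2002, §4 p. 12 (doi:10.1080/10586458.2002.10504701: «powers of 2 divide the modular degree, as might be suggested from an analysis of Atkin–Lehner involutions» — heuristic only, shape)] -/
@[conjecture]
def FourStarLocalTwoTorsionFourDividesDegree : Prop :=
  ∀ (W : WeierstrassCurve ℚ) [W.IsElliptic] [W.IsGloballyMinimal] [NeZero (W.conductorNorm ℤ)]
    (D : ModularParametrizationData W (W.conductorNorm ℤ)),
    IsTypeFourStarAtTwoTame W → ¬ NoLocalTwoTorsionAtTwo W → ¬ HasRationalTwoTorsion W → 4 ∣ D.modularDegree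

/-- The `c₄`-currency form of E-es-168 (E-blind in the model's invariants): IV* at `2`, `v₂(c₄) = 4`, no rational 2-torsion
⟹ `4 ∣ deg φ`.  PROVED from E-es-168 + the dictionary E-es-170. -/
theorem four_dvd_modularDegree_of_fourStar_c4 (h168 : FourStarLocalTwoTorsionFourDividesDegree)
    (h170 : FourStarHasseDepthDictionary)
    (W : WeierstrassCurve ℚ) [W.IsElliptic] [W.IsGloballyMinimal] [NeZero (W.conductorNorm ℤ)]
    (D : ModularParametrizationData W (W.conductorNorm ℤ))
    (hIV : IsTypeFourStarAtTwoTame W) (hc4 : padicValRat 2 W.c₄ = 4) (hT : ¬ HasRationalTwoTorsion W) :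
    4 ∣ D.modularDegree :=
  h168 W D hIV ((h170 W hIV).mp hc4) hT

/-- **Row E-es-169 `GaussianLevelFourDividesDegree`** (LAW; es g36 MEMO-es §57.5; nothing asserted).  Every modular
parametrisation at the conductor level of a curve with `4 ∥ N`, all odd prime factors of `N` `≡ 1 (mod 4)` («Gaussian
level»: the supersingular locus of `X₀(N/4)_𝔽̄₂` has `i`-points, desc THEOREM J) and no rational 2-torsion point has
degree divisible by `4`.  Census (all curves, `N < 5·10⁵`): 7 256 / 7 256 (optimal: IV 1 349 + 929, IV* 2 821 + 1 693;
non-optimal 89 + 56 + 193 + 126), 0 exceptions; at non-Gaussian levels `deg φ ≡ 2 (mod 4)` occurs 974 times among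
optimal curves without 2-torsion (IV 247 + 240, IV* 133, + IV with torsion 354).  Mechanism: OPEN (candidates: the
Atkin–Lehner 2-group acting on the type-1 / `C₂` points of the semistable fibre with orbits of even size and equal
degrees — desc THEOREM L (iii) is the Gaussian-component instance; or a `χ₋₄`-self-map of the fibre).
Why it might fail: a Gaussian level `4pq` where the type-1 orbit structure has an odd part; none below `5·10⁵`.
[cite: CalegariEmerton2009, Thm. 1.1 (arXiv:math/0503359 p. 2: the parity floor; the mod-4 law at Gaussian levels is the cell's E-es-169, NOT in print)] -/
@[conjecture]
def GaussianLevelFourDividesDegree : Prop :=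
  ∀ (W : WeierstrassCurve ℚ) [W.IsElliptic] [W.IsGloballyMinimal] [NeZero (W.conductorNorm ℤ)]
    (D : ModularParametrizationData W (W.conductorNorm ℤ)),
    padicValNat 2 (W.conductorNorm ℤ) = 2 → AllOddPrimeFactorsOneModFour (W.conductorNorm ℤ) →
      ¬ HasRationalTwoTorsion W → 4 ∣ D.modularDegree

/-- **Row E-es-169b `GaussianLevelFourDividesDegreeWithTorsion`** (LAW): at a Gaussian level which is NOT of the form
`4(s² + 4)`, also the curves WITH a rational 2-torsion point have `4 ∣ deg φ` (2 866 / 2 866: optimal IV 1 396,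
non-optimal IV 37, non-optimal IV* 1 433); the 112 curves of the 55 `s² + 4` classes are the only Gaussian-level curves
with `4 ∤ deg φ` below `5·10⁵`. -/
@[conjecture]
def GaussianLevelFourDividesDegreeWithTorsion : Prop :=
  ∀ (W : WeierstrassCurve ℚ) [W.IsElliptic] [W.IsGloballyMinimal] [NeZero (W.conductorNorm ℤ)]
    (D : ModularParametrizationData W (W.conductorNorm ℤ)),
    padicValNat 2 (W.conductorNorm ℤ) = 2 → AllOddPrimeFactorsOneModFour (W.conductorNorm ℤ) →
      HasRationalTwoTorsion W → ¬ IsFourSquarePlusFourLevel (W.conductorNorm ℤ) → 4 ∣ D.modularDegree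

/-- E-es-169 in desc's `HasPrimeFactorThreeModFour` currency: `4 ∥ N`, NO prime factor `≡ 3 (mod 4)`, no rational
2-torsion ⟹ `4 ∣ deg φ` (one-line edge through `not_hasPrimeFactorThreeModFour_iff`). -/
theorem four_dvd_modularDegree_of_not_hasPrimeFactorThreeModFour (h169 : GaussianLevelFourDividesDegree)
    (W : WeierstrassCurve ℚ) [W.IsElliptic] [W.IsGloballyMinimal] [NeZero (W.conductorNorm ℤ)]
    (D : ModularParametrizationData W (W.conductorNorm ℤ))
    (h2 : padicValNat 2 (W.conductorNorm ℤ) = 2) (hG : ¬ HasPrimeFactorThreeModFour (W.conductorNorm ℤ))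
    (hT : ¬ HasRationalTwoTorsion W) : 4 ∣ D.modularDegree :=
  h169 W D h2 ((not_hasPrimeFactorThreeModFour_iff _).mp hG) hT

/-- The two laws together decide `deg φ (mod 4)` = `0` for every torsion-free curve on the tame cell OUTSIDE the class
«non-Gaussian level ∧ (IV, or IV* without local 2-torsion)» — the habitat of all 974 + … curves with `deg φ ≡ 2 (mod 4)`.
(Trivial disjunction edge, recorded for the census bookkeeping.) -/
theorem four_dvd_modularDegree_of_laws (h168 : FourStarLocalTwoTorsionFourDividesDegree)
    (h169 : GaussianLevelFourDividesDegree)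
    (W : WeierstrassCurve ℚ) [W.IsElliptic] [W.IsGloballyMinimal] [NeZero (W.conductorNorm ℤ)]
    (D : ModularParametrizationData W (W.conductorNorm ℤ)) (hT : ¬ HasRationalTwoTorsion W)
    (h : (IsTypeFourStarAtTwoTame W ∧ ¬ NoLocalTwoTorsionAtTwo W) ∨
      (padicValNat 2 (W.conductorNorm ℤ) = 2 ∧ AllOddPrimeFactorsOneModFour (W.conductorNorm ℤ))) :
    4 ∣ D.modularDegree := by
  rcases h with ⟨hIV, hloc⟩ | ⟨h2, hG⟩
  · exact h168 W D hIV hloc hT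
  · exact h169 W D h2 hG hT


/-! ## Appendix (ref1 g20, typed by the typer g21): the rational-2-torsion IV* optimal curves are the `s² + 4` family -/

/-- **E-ref1-g20-1 `FourStarRationalTwoTorsionIsFamily`** (refuter ref1 g20, REFUTER-ref1.md §R203, ask A-ref1-g20-2; typed
by the typer g21 at ref1's request, statement as printed on the bus): on the tame cell `4 ∥ N`, a globally minimal curve of
Kodaira type IV* at `2` which is `X₀(N)`-LATTICE-OPTIMAL (`Λ_W = c·Λ_f`, the body of `IsLatticeOptimal D`
spelled out as in `ShimuraCover.ShimuraKernelForcesClassTorsion`, to keep this file's imports unchanged) and HAS a rational `2`-torsion point has conductor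
`N = 4(s² + 4)` for some integer `s` — i.e. the torsion clause excluded in E-es-168 / E-desc-38 is exactly the `u`-family
level shape (E-111's Hasse-depth-1 clause).  Census (ref1 e203, exact integer engines): 55 / 55 such optimal curves, 0
exceptions among the 79 280 optimal IV* curves with `N < 5·10⁵`.  Why it might fail: an optimal IV* curve with a rational
2-torsion point at a level `4m`, `m` not of the form `s² + 4`, beyond `5·10⁵`.  bears_on: stmt-BirchSwinnertonDyer-22967 (C2).
[conjecture — census law, nothing asserted] [cite: CremonaEcdata, conductors < 500000 (ref1 pack HOME/ref1/e203)] -/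
@[conjecture]
def FourStarRationalTwoTorsionIsFamily : Prop :=
  ∀ (W : WeierstrassCurve ℚ) [W.IsElliptic] [W.IsGloballyMinimal] {N : ℕ} [NeZero N]
    (D : ModularParametrizationData W N), W.conductorNorm ℤ = N →
    (∀ z ∈ D.L.lattice, ∃ w ∈ periodLattice D.f, z = D.c * w) →  -- `IsLatticeOptimal D`, spelled out (no extra import)
    IsTypeFourStarAtTwoTame W → HasRationalTwoTorsion W → ∃ s : ℤ, (N : ℤ) = 4 * (s ^ 2 + 4)

end Summit.BirchSwinnertonDyer.Rank1Residual.ManinAdditive.HasseDepth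

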